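import Summits.Ventures.CertifiedManyBodySolver.Certificates.HubbardSquare_tpm3o10_U29o5_toyKernelCert_pauliRow
import Summits.Ventures.CertifiedManyBodySolver.Rows.CorrWindowCertKernelFormGram
import HarnessLib

/-!
# STEP-0 of «tier P», TWO-LEVEL GRAM edition: the Pauli row `Re ω(n_{0↓}) ≤ 1` from a window certificate whose Gram family is a
# symmetry-adapted 2 × 2 BLOCK `Σ_{i,j} (R Rᵀ)_{ij}/4 · vᵢ† vⱼ` (`v₁ = 1`, `v₂ = n_{0↓}`, `R = [[2, 0], [−2]]`, dyadic scale `K = 1`),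
# replayed in the kernel through `affineOrbitLowerRowN_of_kernelCertTB` — ZERO hypotheses, NO claim node

HONEST FRAMING: a TOY (the Pauli bound is textbook); the point is that the two-level Gram shape of
`Rows/CARPolyWindowGramTwoLevel.lean` — integer factor rows of unequal length (zero-padding exercised), dyadic scale, basis
POLYNOMIALS rather than words, Gram entry `idot rᵢ rⱼ / 4^K` computed by the kernel, positivity never tested (PSD by construction) —
runs end to end through the abstract-slot kernel theorem of `Rows/CorrWindowCertKernelFormGram.lean` exactly as the SOS-factor
shape did in `…_toyKernelCert_pauliRow`: the normal-orderer finds `(1 − n) − (1 − 2n + n·n) = 0` (`n² = n`), `decide +kernel`.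
Trust base: the Lean kernel (std axioms). No number of record; no existing claim node discharged; CONTROL/CALIBRATION context (wording
(xx1)); silent on ρ_s = 0 / presence / T_c / phase; nothing about La₂CuO₄; no summit statement is proved by this file. Seat
hubbard-obs-p2 (STIFFNESS), `prover-hubbard-obs-p2-g22-0`, zero compute.

References: J. Wang et al., PRX 14 (2024) 031006 §III [WangEtAl2024]; X. Han, arXiv:2006.06002 §2 eq. (2) [Han2020Bootstrap].
-/

noncomputable section

namespace Summit.Ventures.CertifiedManyBodySolver

namespace CARPolyWindow

namespace Toy3x3

open Summit.Ventures.CertifiedQuantumChemistry Summit.Ventures.CertifiedQuantumChemistry.CARPoly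
open Literature.MathematicalPhysics.QuantumLattice Literature.MathematicalPhysics.QuantumLattice.HubbardWave0
open Literature.MathematicalPhysics.QuantumManyBody.StateRelaxation
open Literature.Probability.LatticeModels ThermodynamicLimit Filter Topology
open Matrix
open scoped ComplexOrder BigOperators

/-! ## The certificate data (spin `1 = ↓` at the origin letter `ix 0`) -/

/-- The objective `1 − n_{0↓}` as a term list. [folklore] -/
def TXd : Terms (Orb (Fin 9)) := [([], 1), ([(orb (ix 0) 1, true), (orb (ix 0) 1, false)], -1)]

/-- ONE symmetry-adapted Gram block: basis polynomials `v₁ = 1`, `v₂ = n_{0↓}` with integer factor rows `[2, 0]`, `[−2]` (so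
`R Rᵀ / 4 = [[1, −1], [−1, 1]]` and the block denotes `1 − 2 n_{0↓} + n_{0↓}² = 1 − n_{0↓}`). [cite: Han2020Bootstrap, §2 eq. (2)] -/
def blocksd : List (List (List ℤ × Terms (Orb (Fin 9)))) :=
  [[([2, 0], unitT 1), ([-2], [([(orb (ix 0) 1, true), (orb (ix 0) 1, false)], 1)])]]

/-- The residual of the two-level toy certificate (no density / energy / eom / symmetry / charged / anti-Hermitian families).
[cite: WangEtAl2024, §III] -/
def toyResidTB : Terms (Orb (Fin 9)) :=
  residTG TXd (fun _ => 0) 0 (fun σ => orb (ix 0) σ) 0 0 0 0 TE (gramTB 1 blocksd) TH (fun b : Fin 0 => b.elim0) []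
    (fun l : Fin 0 => l.elim0) (fun l : Fin 0 => l.elim0) [] []

/-- **The kernel evaluation**: `0 ≤ lowerConst (normalize ((1 − n_{0↓}) − Σ_{i,j} (R Rᵀ)_{ij}/4 · vᵢ† vⱼ))` (in fact `= 0`).
Decided by the kernel. [cite: WangEtAl2024, §III] -/
theorem toyTB_lowerConst :
    (0 : ℚ) ≤ lowerConst (CARPoly.normalize enc 32 toyResidTB) + (0 + 0) * ((7 / 8 : ℚ) / 2 - 0) := by
  decide +kernel

/-! ## The end-to-end theorem -/

/-- Membership-proof irrelevance for ordered sites. [folklore] -/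
private theorem pt_congr_site₄ {x y : Site 2} (hx : x ∈ W) (hy : y ∈ W) (h : x = y) :
    PolySite.pt x hx = PolySite.pt y hy := by
  subst h; rfl

/-- **STEP-0, two-level edition: the affine-N claim-node predicate for `1 − n_{0↓}` at the La214-E station `(1, −3/10, 29/5)`,
value `0`, from the kernel-replayed TWO-LEVEL certificate — ZERO hypotheses.** [cite: WangEtAl2024, §III] -/
theorem toyTB_affineOrbitLowerRowN :
    SquareTTPrimeCorrAffineOrbitLowerRowN (((-3 / 10 : ℚ)) : ℝ) (((29 / 5 : ℚ)) : ℝ) 0 0 0 0 0 0 (7 / 8) {1} W (termOp d TXd) := by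
  have hz : (0 : Site 2) ∈ W := zero_mem_thicken_zero 1
  have h1 : (1 : DihedralGroup 4) ∈ ({1} : Finset (DihedralGroup 4)) := Finset.mem_singleton_self 1
  have hmul : ∀ a ∈ ({1} : Finset (DihedralGroup 4)), ∀ b ∈ ({1} : Finset (DihedralGroup 4)),
      a * b ∈ ({1} : Finset (DihedralGroup 4)) := by
    intro a ha b hb
    rw [Finset.mem_singleton] at ha hb ⊢
    rw [ha, hb, mul_one]
  have hΛ : ({0} : Finset (Site 2)) ⊆ W := Finset.singleton_subset_iff.2 hz
  have hix0 : xs (ix 0) = 0 := xs_ix_of_mem 0 hz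
  have ho : ∀ σ : Fin 2, d (orb (ix 0) σ) = orb (PolySite.pt 0 hz) σ := by
    intro σ
    rw [d_orb, pt_congr_site₄ (xs_mem (ix 0)) hz hix0]
  have hH : termOp d TH = (hubbardTTPrimeFermionInteraction 1 (((-3 / 10 : ℚ)) : ℝ) (((29 / 5 : ℚ)) : ℝ)).localHamiltonian W := by
    rw [TH, termOp_hamTermsIdx 1 (-3 / 10) (29 / 5) xs xs_mem xs_injective xs_cover d d_orb, Rat.cast_one]
  have hE : termOp d TE = fermionEmbed (PolySite.incl (subset_refl W))
      ((hubbardTTPrimeFermionInteraction 1 (((-3 / 10 : ℚ)) : ℝ) (((29 / 5 : ℚ)) : ℝ)).meanEnergyObs 1) := by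
    rw [TE, termOp_energyTermsIdx 1 (-3 / 10) (29 / 5) xs xs_mem (subset_refl W) ix xs_ix_of_mem d d_orb, Rat.cast_one]
  exact affineOrbitLowerRowN_of_kernelCertTB (-3 / 10) (29 / 5) (by norm_num) hΛ (subset_refl W) (subset_refl W) hz h1 hmul
    d d_injective enc 32 (fun b : Fin 0 => b.elim0) (fun b : Fin 0 => b.elim0) (fun b => b.elim0)
    (fun p => (ofLex p).2) (fun _ => rfl) TH hH TE hE (fun σ => orb (ix 0) σ) ho TXd (fun _ => 0) 0 0 0 0 0 1 blocksd []
    (fun l : Fin 0 => l.elim0) (fun l => l.elim0) (fun l : Fin 0 => l.elim0) (fun l : Fin 0 => l.elim0)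
    (fun l => l.elim0) (fun l => l.elim0) (fun l : Fin 0 => l.elim0) [] (fun wc hwc => absurd hwc (List.not_mem_nil)) []
    (by norm_num) toyTB_lowerConst

/-- The objective IS `1 − n_{0↓}`. [folklore] -/
theorem termOp_TXd : termOp d TXd = 1 - nAt 0 (zero_mem_thicken_zero 1) 1 := by
  have hz : (0 : Site 2) ∈ W := zero_mem_thicken_zero 1
  rw [TXd, termOp_cons, termOp_cons, termOp_nil, add_zero, Rat.cast_one, one_smul, Rat.cast_neg, Rat.cast_one, neg_one_smul,
    ← sub_eq_add_neg]
  have hix0 : xs (ix 0) = 0 := xs_ix_of_mem 0 hz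
  have ho : d (orb (ix 0) 1) = orb (PolySite.pt 0 hz) 1 := by
    rw [d_orb, pt_congr_site₄ (xs_mem (ix 0)) hz hix0]
  have hw0 : wmap d ([] : List (Orb (Fin 9) × Bool)) = [] := rfl
  have hw1 : wmap d [(orb (ix 0) 1, true), (orb (ix 0) 1, false)] = [(d (orb (ix 0) 1), true), (d (orb (ix 0) 1), false)] := rfl
  rw [hw0, hw1, ho, ladderWord_nil, ladderWord_cons, ladderWord_cons, ladderWord_nil, mul_one]
  congr 1

/-- **THE `↓` PAULI ROW, KERNEL-REPLAYED FROM A TWO-LEVEL CERTIFICATE**: for every density `x ∈ [0, 2)` and every torus limit `ω`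
of unit sector ground states of `hubbardTorusTT' L 1 (−3/10) (29/5)` along `L → ∞`: `0 ≤ Re ω(1 − n_{0↓})`.
[cite: WangEtAl2024, §III] -/
theorem toyTB_pauli_row (x : ℝ) (hx0 : 0 ≤ x) (hx2 : x < 2) (ω : InfVolFermionState 2) (Ls : ℕ → ℕ)
    (ψ : ∀ L, Fock (Orb (FermionTorus 2 L))) (hLs : Tendsto Ls atTop atTop)
    (hψ : ∀ j, IsGroundStateInSector (hubbardTorusTT' (Ls j) 1 (((-3 / 10 : ℚ)) : ℝ) (((29 / 5 : ℚ)) : ℝ)) (rectN x (Ls j)) 0 (ψ (Ls j)))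
    (hψ1 : ∀ j, star (ψ (Ls j)) ⬝ᵥ ψ (Ls j) = 1) (hω : ω.IsTorusLimitOf ψ Ls) :
    0 ≤ (ω.expect W (1 - nAt 0 (zero_mem_thicken_zero 1) 1)).re := by
  have h := toyTB_affineOrbitLowerRowN x hx0 hx2 ω Ls ψ hLs hψ hψ1 hω
  rw [termOp_TXd, Finset.sum_singleton, Finset.card_singleton, Nat.cast_one, inv_one, one_mul,
    ω.expect_fermionEmbed_d4Emb_one_zero] at h
  push_cast at h
  linarith

end Toy3x3

end CARPolyWindow

end Summit.Ventures.CertifiedManyBodySolver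

end
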